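import Literature.Analysis.FluidPDE.TaoCascadeReducedClaimIIFromSetting
import Literature.Analysis.FluidPDE.TaoCascadeSmallScaleOneInRegime
import HarnessLib

/-!
# Tao's cascade ODE, §6.7: `ReducedClaimIIInput` from a `Setting`-based Prop. 6.15 with `K` large

T. Tao, *Finite time blowup for an averaged three-dimensional Navier–Stokes equation*,
J. Amer. Math. Soc. 29 (2016), 601–674 = arXiv:1402.0290v3, §6.1 (the hierarchy
`1 ≪ 1/ε₀ ≪ K ≪ 1/ε ≪ n₀`), §6.6 Prop. 6.15, §6.7 ("(and take `K` sufficiently large …)").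

`reducedClaimIIInput_of_setting` (`TaoCascadeReducedClaimIIFromSetting.lean`) discharges the regime
input `ReducedClaimIIInput` (Prop. 6.15) of the assembly of Prop. 6.5 from any proof of Prop. 6.15 in
the packaging `ZeroScale.Setting` of §6.7, whose parameter regime `ZeroScale.Regime` has `K ≥ 10⁶`.
The §6.7 argument needs `K` larger than that at one place: Prop. 6.17 ("no exit to coarse scales")
rests on the mismatch `c₀(τ₁) ≤ 2K⁻¹⁰ε² exp(4K¹⁰K^{-1/2}) ≪ c₋₁ ≥ exp(6·10⁻⁸K¹⁰)ε²`, i.e.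
`√K ≳ 10⁸` (`TaoCascadeZeroScaleCoarseBound.lean` uses `K ≥ 10¹⁸`). This file records the variant
of the discharge with an arbitrary additional largeness threshold `K₁ ≤ K` on the `Setting`-based
Prop. 6.15 (`reducedClaimIIInput_of_setting_of_le`), absorbed by "`K` sufficiently large depending on
`ε₀`" (`InRegime.of_K`), and the resulting reductions of the corrected Prop. 6.5
(`rescaledStepCorrected'_of_setting_of_le`, via `rescaledStepCorrected'_of_reducedClaimIIInput` of
`TaoCascadeSmallScaleOneInRegime.lean`, Prop. 6.13 being discharged there). Theorems only.

## References

* T. Tao, J. Amer. Math. Soc. 29 (2016), 601–674 = arXiv:1402.0290v3, §6.1, §6.6 Props. 6.13, 6.15,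
  §6.7 Prop. 6.17. [`Tao2016AveragedNS`]
-/

noncomputable section

open Set MeasureTheory intervalIntegral Filter
open scoped _root_.Topology

namespace Literature.Analysis.FluidPDE

namespace TaoCascade

open Literature.Analysis.ODE

/-- **`ReducedClaimIIInput` (Prop. 6.15 in the regime) from a `Setting`-based Prop. 6.15 that assumes
in addition `K₁ ≤ K`** for some threshold `K₁`. [cite: Tao2016AveragedNS, §6.6 Prop. 6.15; §6.7] -/
theorem reducedClaimIIInput_of_setting_of_le (K₁ : ℝ)
    (h615 : ∀ ⦃ε₀ K ε C₁ C₂ C₃ C₄ C₅ : ℝ⦄ ⦃n₀ N : ℤ⦄ ⦃τ : ℤ → ℝ⦄ ⦃Y : Fin 4 → ℤ → ℝ → ℝ⦄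
      ⦃F : ℤ → ℝ → ℝ⦄ ⦃T : ℝ⦄, ZeroScale.Setting ε₀ K ε C₁ C₂ C₃ C₄ C₅ n₀ N τ Y F T → K₁ ≤ K →
        ZeroScale.ExitTrichotomy ε₀ K Y F T →
          ∃ τ₁ ∈ Icc (1 / 100 : ℝ) T, ZeroScale.NextState ε₀ K ε Y F τ₁) :
    ReducedClaimIIInput := by
  -- the regime conditions, with `C₄ = 11`, `C₅ = C₂ (1+ε₀)² (cumEnergyConst ε₀ C₃ + 100)`
  have hK6 : InRegime (fun K => 1 / 10 ^ 5 * Real.exp (-K ^ 10 / 2)) fun D => (10 : ℝ) ^ 6 ≤ D.K :=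
    InRegime.of_K (p := fun _ _ K => (10 : ℝ) ^ 6 ≤ K) fun _ _ _ _ _ => eventually_ge_atTop _
  have hK₁ : InRegime (fun K => 1 / 10 ^ 5 * Real.exp (-K ^ 10 / 2)) fun D => K₁ ≤ D.K :=
    InRegime.of_K (p := fun _ _ K => K₁ ≤ K) fun _ _ _ _ _ => eventually_ge_atTop _
  have hKε₀ : InRegime (fun K => 1 / 10 ^ 5 * Real.exp (-K ^ 10 / 2)) fun D =>
      (10 : ℝ) ^ 6 ≤ D.K * D.ε₀ := by
    refine InRegime.of_K (p := fun ε₀ _ K => (10 : ℝ) ^ 6 ≤ K * ε₀) fun ε₀ _ hε₀ _ _ => ?_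
    exact (tendsto_id.atTop_mul_const hε₀).eventually_ge_atTop _
  have hε1 : InRegime (fun K => 1 / 10 ^ 5 * Real.exp (-K ^ 10 / 2)) fun D => D.ε ≤ 1 := by
    refine InRegime.of_eps (p := fun _ _ _ ε => ε ≤ 1) fun _ _ _ _ _ _ _ => ?_
    have : Iio (1 : ℝ) ∈ 𝓝[>] (0 : ℝ) := mem_nhdsWithin_of_mem_nhds (Iio_mem_nhds (by norm_num))
    exact Filter.mem_of_superset this fun ε (hε : ε < 1) => (le_of_lt hε : ε ≤ 1)
  have hεexp : InRegime (fun K => 1 / 10 ^ 5 * Real.exp (-K ^ 10 / 2)) fun D =>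
      D.ε * Real.exp (10 ^ 6 * D.K ^ 10) ≤ 1 :=
    InRegime.of_eps (p := fun _ _ K ε => ε * Real.exp (10 ^ 6 * K ^ 10) ≤ 1) fun _ _ K _ _ _ _ =>
      eventually_nhdsGT_mul_exp_le_one _
  have hlate : InRegime (fun K => 1 / 10 ^ 5 * Real.exp (-K ^ 10 / 2)) fun D =>
      (D.C₁ + D.C₂ + D.C₂ * (1 + D.ε₀) ^ (2 : ℝ) * (cumEnergyConst D.ε₀ D.C₃ + 100) + 1) *
        (1 + D.ε₀) ^ (-(D.n₀ : ℝ) / 4) ≤ D.ε ^ 4 * Real.exp (-10 * D.K ^ 10) := by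
    refine InRegime.of_n0 (p := fun ε₀ K ε C₁ C₂ C₃ n₀ =>
      (C₁ + C₂ + C₂ * (1 + ε₀) ^ (2 : ℝ) * (cumEnergyConst ε₀ C₃ + 100) + 1) *
        (1 + ε₀) ^ (-(n₀ : ℝ) / 4) ≤ ε ^ 4 * Real.exp (-10 * K ^ 10))
      fun ε₀ K ε C₁ C₂ C₃ hε₀ _ _ hε _ _ _ => ?_
    exact eventually_mul_rpow_neg_quarter_le hε₀ _ (by positivity)
  have hK2 : InRegime (fun K => 1 / 10 ^ 5 * Real.exp (-K ^ 10 / 2)) fun D => 11 ≤ D.K :=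
    InRegime.of_K (p := fun _ _ K => 11 ≤ K) fun _ _ _ _ _ => eventually_ge_atTop _
  unfold ReducedClaimIIInput
  refine ((((((hK6.and hKε₀).and hε1).and hεexp).and hlate).and hK2).and hK₁).mono ?_
  rintro D hD ⟨⟨⟨⟨⟨⟨hK6D, hKε₀D⟩, hε1D⟩, hεexpD⟩, hlateD⟩, hK2D⟩, hK₁D⟩ T hT hgood hb13 hint hex
  have hK1 : 1 ≤ D.K := by linarith
  have hK2' : 2 ≤ D.K := by linarith
  -- `SmallModes K ε 11` from the absorbed bounds of Prop. 6.13
  have hsmall : ZeroScale.SmallModes D.K D.ε 11 D.Y T := by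
    refine ⟨fun t ht => (hb13 t ht).1, fun t ht => ((hb13 t ht).2.1).trans ?_⟩
    have hx : D.K ^ (-(1 : ℝ) / 4) ≤ 11 :=
      (Real.rpow_le_one_of_one_le_of_nonpos hK1 (by norm_num)).trans (by norm_num)
    have h0 : 0 ≤ Real.exp (-D.K ^ 10 / 2) * D.ε ^ 2 := by positivity
    calc D.K ^ (-(1 : ℝ) / 4) * Real.exp (-D.K ^ 10 / 2) * D.ε ^ 2
        = D.K ^ (-(1 : ℝ) / 4) * (Real.exp (-D.K ^ 10 / 2) * D.ε ^ 2) := by ring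
      _ ≤ 11 * (Real.exp (-D.K ^ 10 / 2) * D.ε ^ 2) := mul_le_mul_of_nonneg_right hx h0
      _ = 11 * Real.exp (-D.K ^ 10 / 2) * D.ε ^ 2 := by ring
  -- the context of §6.7 at `T`
  have hctx := hD.hyp.zeroScale_context hD.ε₀_pos hD.ε₀_lt_one hK2' hD.ε_pos hε1D hD.C₁_nonneg
    hD.C₂_nonneg hD.C₃_nonneg hD.n₀_le_N hT hgood (by norm_num : (0 : ℝ) ≤ 11) hsmall
  -- the setting
  have hs : ZeroScale.Setting D.ε₀ D.K D.ε D.C₁ D.C₂ D.C₃ 11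
      (D.C₂ * (1 + D.ε₀) ^ (2 : ℝ) * (cumEnergyConst D.ε₀ D.C₃ + 100)) D.n₀ D.N D.τ D.Y D.F T :=
    { toContext := hctx
      K_large := hK6D
      Kε₀ := hKε₀D
      C₄_le := hK2D
      ε_exp := hεexpD
      late := hlateD }
  exact h615 hs hK₁D hex

/-- **The corrected Prop. 6.5 (`rescaledStepCorrected'`) from a `Setting`-based Prop. 6.15 with an
extra threshold `K₁ ≤ K`** (Prop. 6.13 is discharged by `smallScaleOneInput_holds`).
[cite: Tao2016AveragedNS, §6.6–6.7] -/
theorem rescaledStepCorrected'_of_setting_of_le (K₁ : ℝ)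
    (h615 : ∀ ⦃ε₀ K ε C₁ C₂ C₃ C₄ C₅ : ℝ⦄ ⦃n₀ N : ℤ⦄ ⦃τ : ℤ → ℝ⦄ ⦃Y : Fin 4 → ℤ → ℝ → ℝ⦄
      ⦃F : ℤ → ℝ → ℝ⦄ ⦃T : ℝ⦄, ZeroScale.Setting ε₀ K ε C₁ C₂ C₃ C₄ C₅ n₀ N τ Y F T → K₁ ≤ K →
        ZeroScale.ExitTrichotomy ε₀ K Y F T →
          ∃ τ₁ ∈ Icc (1 / 100 : ℝ) T, ZeroScale.NextState ε₀ K ε Y F τ₁) :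
    rescaledStepCorrected' :=
  rescaledStepCorrected'_of_reducedClaimIIInput (reducedClaimIIInput_of_setting_of_le K₁ h615)

end TaoCascade

end Literature.Analysis.FluidPDE
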